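import Literature.IUT.HodgeTheaters.StableCurveTemperedDataOfSpecialFibreProp24iiArithLiteral
import HarnessLib

/-!
# The §2 one-call at the CANONICAL [SemiAnbd] Prop 5.2 (iv) frame `Π^tp_j ↠ Π^tp_j ⧸ π₁^temp(𝒢_j)`: the frame is
# CONSTRUCTED and the `hI` socket is FRAME-INDEPENDENT ([IUTchI] Prop. 2.4 (ii), pp. 50–51)

S. Mochizuki, *Inter-universal Teichmüller theory I*, kurims manuscript (May 2020), §2, proof of Prop. 2.4 (ii), p. 50
l. 52 – p. 51 l. 13 [cite: Mochizuki2012, Prop 2.4(ii) pp.50-51] (D-0012 claim key; nothing of the series is asserted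
here), over S. Mochizuki, *Semi-graphs of anabelioids*, Publ. RIMS **42** (2006), Prop. 5.2 (iv) p. 64
(`1 → π₁^temp(𝒢) → Π^temp_𝔊 → Π_A → 1`), Def. 5.3 (i) p. 65, Thm. 5.4 (i) p. 66 [cite: MochizukiSemiAnbd2006, Prop 5.2 (iv) p.64];
[SemiAnbd] §6 p. 69 (`Π^temp_{X_K} ↠ G_K` open: abc-iut-L3's `TemperedCurve.isOpenMap_augGK_of_isTempered`).

PROOF-ONLY file (abc-iut cell, L5 [IUTchI] §2 lineage, abc-iut-L5-t11 gen 13, row «SEC2-NV-LITERAL-FRAME» part (F);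
no definition, no instance, no notation, no new `Prop` fact).  State of record: the §2 one-call
`prop24_cor25_ofPiData_byName_noRF_literal` (abc-iut-L5-t11 gen 11, p485729) carries the per-level LAW `hI_j^lit` —
«`ArithMaximalCompactStatementI (Dd j) (α j)` for ANY open homomorphism `α_j` out of `Π^tp_j := Π^temp_{X_K} ⧸ admKer_j`
killing `N̄_j := N_j ⧸ admKer_j = π₁^temp(𝒢_j)`» — together with DISPLAYED frame data `{PA j, α j, hαo, hαN}`.  Here:

* § A (generic): ASCENT of [SemiAnbd] Def 5.3 (i) arithmetic ampleness from a continuous `α` to an OPEN `aug` with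
  `Ker α ≤ Ker aug` (`isArithAmple_of_isArithAmple_of_ker_le`, `arithMaximalCompactStatementI_of_ker_le`) — the converse
  companion of p485729's finite-index DESCENT `ArithAmpleDescent.arithMaximalCompactStatementI_of_isOpenMap`;
* § B (the genuine 𝔛-datum over `P : PiData`): the CANONICAL [SemiAnbd] Prop 5.2 (iv) frame
  `πA_j : Π^tp_j ↠ Π^tp_j ⧸ N̄_j (≅ Π^temp_{X_K} ⧸ N_j)` is CONSTRUCTED — `N̄_j ⊴ Π^tp_j` (`qTower_map_N_normal`), closed
  (`isClosed_qTower_map_N`), `πA_j` open and killing `N_j` (`isOpenMap_frame`, `frame_apply_eq_one`), `Ker πA_j = N̄_j`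
  EXACTLY; the canonical augmentation `a_j : Π^tp_j → G_K` (`a_j ∘ qtp_j = (Π^temp_{X_K} ↠ G_K)`) is continuous and OPEN
  (`canonicalAug_continuous_isOpenMap_ker`: `Π^temp_{X_K}` is tempered and Galois-countable, [SemiAnbd] §6, abc-iut-L3's
  `TemperedCurve.isOpenMap_augGK_of_isTempered`); hence **`arithStatementI_frame_iff_canonical`**:
  `StatementI (Dd j) πA_j ↔ StatementI (Dd j) a_j` at EVERY level of EVERY genuine datum — the §2 `hI` socket is
  FRAME-INDEPENDENT (the canonical law of p467772, the literal law of p485729 and the frame law are logically equivalent;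
  the frame / literal TYPE is the one matching abc-iut-L3's Thm 5.4 output `hexact : ι.range = aug.ker`); and the one-call
  **`prop24_cor25_ofPiData_byName_noRF_frame`** = p485729's literal one-call with the frame data `{PA, α, hαo, hαN}`
  ELIMINATED (constructed), the law reading `hI_j^frame : ArithMaximalCompactStatementI (Dd j) πA_j` (law count 6
  unchanged: hTF · hNN_i · hab · hadm · hI_j^frame · hA3ar_j).  Non-vacuity of the frame / literal one-call is part (G),
  `StableCurveTemperedDataOfSpecialFibreSec2OneCallNVLiteral`.

HONEST TAGS.  Bookkeeping on frames: NOTHING of [SemiAnbd] Thm 5.4 is proved here; `hI^frame` stays a LAW (abc-iut-L3's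
typed predicate `ArithMaximalCompactStatementI`, proved by L3 at produced chart data, not at `Π^tp_j`).  CONDITIONAL as
labelled; typed ≠ inhabited ≠ discharged; nothing here asserts that abc is proved or refuted, and nothing here bears on
[IUTchIII] Cor. 3.12.
-/

noncomputable section

namespace Literature.IUT.HodgeTheaters

open _root_.Topology
open scoped Pointwise
open Literature.AnabelianGeometry.SemiGraphs Literature.AnabelianGeometry.SemiGraphs.ProfiniteSemiGraph

/-! ### A. Generic: ascent of arithmetic ampleness to an open augmentation with larger kernel -/

namespace ArithAmpleDescent

variable {Gtp : Type*} [Group Gtp] [TopologicalSpace Gtp]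
  {PA : Type*} [Group PA] [TopologicalSpace PA]
  {PA' : Type*} [Group PA'] [TopologicalSpace PA']

/-- **Ascent of arithmetic ampleness ([SemiAnbd] Def 5.3 (i)) to an open augmentation with larger kernel.**  If
`α : Π → Π'_A` is continuous, `aug : Π → Π_A` is an OPEN homomorphism and `Ker α ≤ Ker aug`, then every `α`-ample
`K` is `aug`-ample: `K · Ker α = α⁻¹(α(K))` is open, hence so is `aug(K) = aug(K · Ker α)`.
[cite: MochizukiSemiAnbd2006, Def 5.3 (i), p. 65] -/
theorem isArithAmple_of_isArithAmple_of_ker_le {aug : Gtp →* PA} (haug : IsOpenMap aug) {α : Gtp →* PA'}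
    (hα : Continuous α) (hker : α.ker ≤ aug.ker) {K : Subgroup Gtp} (hample : IsArithAmple α K) :
    IsArithAmple aug K := by
  have hopen : IsOpen ((K ⊔ α.ker : Subgroup Gtp) : Set Gtp) := by
    rw [← Subgroup.comap_map_eq, Subgroup.coe_comap]
    exact hample.preimage hα
  have hmap : (K ⊔ α.ker).map aug = K.map aug := by
    rw [Subgroup.map_sup, (Subgroup.map_eq_bot_iff α.ker).mpr hker, sup_bot_eq]
  unfold IsArithAmple
  rw [← hmap, Subgroup.coe_map]
  exact haug _ hopen

/-- **[SemiAnbd] Thm 5.4 (i)'s conclusion ascends along the same change of augmentation**: its conclusion does not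
mention the augmentation, so `ArithMaximalCompactStatementI D aug` for an OPEN `aug` implies
`ArithMaximalCompactStatementI D α` for every continuous `α` with `Ker α ≤ Ker aug`
(`isArithAmple_of_isArithAmple_of_ker_le`). [cite: MochizukiSemiAnbd2006, Thm 5.4 (i), p. 66] -/
theorem arithMaximalCompactStatementI_of_ker_le {V B : Type*} (D : DecompositionData Gtp V B)
    {aug : Gtp →* PA} (haug : IsOpenMap aug) {α : Gtp →* PA'} (hα : Continuous α) (hker : α.ker ≤ aug.ker)
    (hI : ArithMaximalCompactStatementI D aug) : ArithMaximalCompactStatementI D α :=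
  fun K hKc hKa => hI K hKc (isArithAmple_of_isArithAmple_of_ker_le haug hα hker hKa)

end ArithAmpleDescent

/-! ### B. The genuine 𝔛-datum: the canonical Prop 5.2 (iv) frame, frame-independence of the `hI` socket, closers -/

namespace StableCurveTemperedData

namespace OfSpecialFibre

variable {p : ℕ} [Fact p.Prime] (X : TemperedCurve p)
  (d : X.GroupLevelData) (T : SpecialFibreTower X.DeltaTemp)
  (Sigma SigmaHat : Set ℕ) (hsub : Sigma ⊆ SigmaHat) (hne : Set.Nonempty Sigma)
  (hprime : ∀ q ∈ SigmaHat, q.Prime)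
  (S : SpecialFibreData (X.toTemperedArithmeticGroup d)) (h36 : S.Gc.Prop36Hypotheses)
  (hp : p ∉ Sigma) (TpH : Subgroup S.chart.G)
  (HatH : Subgroup (TemperedGraphGroupData.exists_completion_of_prop36 S.Gc h36 S.chart).choose)
  (hle : TpH.map (TemperedGraphGroupData.exists_completion_of_prop36 S.Gc h36
    S.chart).choose_spec.choose.toMonoidHom ≤ HatH)
  (cuspMeetsH : {x : X.Pt // X.IsCusp x} → Prop)

/-- **`N̄_j := N_j ⧸ admKer_j` is NORMAL in the level quotient `Π^tp_j = Π^temp_{X_K} ⧸ admKer_j`** (image of the normal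
subgroup `N_j ⊴ Π^temp_{X_K}`, `map_N_normal`, under the surjection `qtp_j`) — so the [SemiAnbd] Prop 5.2 (iv) frame
`Π_A := Π^tp_j ⧸ N̄_j` is a group. ([IUTchI] Prop 2.4(ii) p.51; [SemiAnbd] Prop 5.2 (iv) p.64) [claim: Mochizuki2012, status: disputed] -/
theorem qTower_map_N_normal (P : SpecialFibreTower.PiData X d S T) (j : ℕ) :
    (((T.N j).map X.DeltaTemp.subtype).map ((qTowerOfSpecialFibreTower X T d S h36 Sigma SigmaHat hsub hne hprime hp TpH HatH hle cuspMeetsH P.admKer_normal_pi).qtp j)).Normal := by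
  haveI : (admKerPi X T j).Normal := P.admKer_normal_pi j
  exact Subgroup.Normal.map (map_N_normal X T j) _
    (qTower_qtp_surjective X T d S h36 Sigma SigmaHat hsub hne hprime hp TpH HatH hle cuspMeetsH P.admKer_normal_pi j)

/-- `N̄_j` is CLOSED in `Π^tp_j`: it is saturated for the open quotient map `qtp_j` (`admKer_j ≤ N_j`) with closed
preimage `N_j` (`isClosed_map_N`). ([IUTchI] Prop 2.4(ii) p.51) [claim: Mochizuki2012, status: disputed] -/
theorem isClosed_qTower_map_N (P : SpecialFibreTower.PiData X d S T) (j : ℕ) :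
    IsClosed (((((T.N j).map X.DeltaTemp.subtype).map ((qTowerOfSpecialFibreTower X T d S h36 Sigma SigmaHat hsub hne hprime hp TpH HatH hle cuspMeetsH P.admKer_normal_pi).qtp j)) :
      Subgroup ((qTowerOfSpecialFibreTower X T d S h36 Sigma SigmaHat hsub hne hprime hp TpH HatH hle cuspMeetsH P.admKer_normal_pi).Q j).Tp) :
      Set ((qTowerOfSpecialFibreTower X T d S h36 Sigma SigmaHat hsub hne hprime hp TpH HatH hle cuspMeetsH P.admKer_normal_pi).Q j).Tp) := by
  haveI hA : (admKerPi X T j).Normal := P.admKer_normal_pi j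
  have hq : IsOpenQuotientMap ((qTowerOfSpecialFibreTower X T d S h36 Sigma SigmaHat hsub hne hprime hp TpH HatH hle cuspMeetsH P.admKer_normal_pi).qtp j) := by
    change IsOpenQuotientMap (QuotientGroup.mk' (admKerPi X T j))
    exact QuotientGroup.isOpenQuotientMap_mk
  have hker : ((qTowerOfSpecialFibreTower X T d S h36 Sigma SigmaHat hsub hne hprime hp TpH HatH hle cuspMeetsH P.admKer_normal_pi).qtp j).ker = admKerPi X T j := by
    change (QuotientGroup.mk' (admKerPi X T j)).ker = _
    exact QuotientGroup.ker_mk' _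
  refine (hq.isQuotientMap.isClosed_preimage).mp ?_
  rw [← Subgroup.coe_comap, Subgroup.comap_map_eq, hker, sup_eq_left.mpr (admKerPi_le_map_N X T j)]
  exact isClosed_map_N X T j

/-- **The canonical Prop 5.2 (iv) frame `πA_j : Π^tp_j ↠ Π^tp_j ⧸ N̄_j` is an OPEN map** (quotient maps of
topological groups are open). ([SemiAnbd] Prop 5.2 (iv) p.64) [claim: Mochizuki2012, status: disputed] -/
theorem isOpenMap_frame (P : SpecialFibreTower.PiData X d S T) (j : ℕ) :
    haveI := qTower_map_N_normal X d T Sigma SigmaHat hsub hne hprime S h36 hp TpH HatH hle cuspMeetsH P j;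
    IsOpenMap (QuotientGroup.mk' (((T.N j).map X.DeltaTemp.subtype).map ((qTowerOfSpecialFibreTower X T d S h36 Sigma SigmaHat hsub hne hprime hp TpH HatH hle cuspMeetsH P.admKer_normal_pi).qtp j))) := by
  haveI := qTower_map_N_normal X d T Sigma SigmaHat hsub hne hprime S h36 hp TpH HatH hle cuspMeetsH P j
  exact QuotientGroup.isOpenMap_coe

/-- **The frame `πA_j` KILLS `N_j`**: `πA_j (qtp_j n) = 1` for `n ∈ N_j` — its kernel is `N̄_j = π₁^temp(𝒢_j)` EXACTLY
(the frame of [SemiAnbd] Prop 5.2 (iv): `Ker(Π^temp_𝔊 ↠ Π_A) = π₁^temp(𝒢)`). ([SemiAnbd] Prop 5.2 (iv) p.64) [claim: Mochizuki2012, status: disputed] -/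
theorem frame_apply_eq_one (P : SpecialFibreTower.PiData X d S T) (j : ℕ) (n : X.DeltaTemp) (hn : n ∈ T.N j) :
    haveI := qTower_map_N_normal X d T Sigma SigmaHat hsub hne hprime S h36 hp TpH HatH hle cuspMeetsH P j;
    QuotientGroup.mk' (((T.N j).map X.DeltaTemp.subtype).map ((qTowerOfSpecialFibreTower X T d S h36 Sigma SigmaHat hsub hne hprime hp TpH HatH hle cuspMeetsH P.admKer_normal_pi).qtp j))
      ((qTowerOfSpecialFibreTower X T d S h36 Sigma SigmaHat hsub hne hprime hp TpH HatH hle cuspMeetsH P.admKer_normal_pi).qtp j (n : X.PiTemp)) = 1 := by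
  haveI := qTower_map_N_normal X d T Sigma SigmaHat hsub hne hprime S h36 hp TpH HatH hle cuspMeetsH P j
  rw [QuotientGroup.mk'_apply, QuotientGroup.eq_one_iff]
  exact Subgroup.mem_map.mpr ⟨(n : X.PiTemp), Subgroup.mem_map.mpr ⟨n, hn, rfl⟩, rfl⟩

/-- **The CANONICAL augmentation `a_j : Π^tp_j → G_K` (`a_j ∘ qtp_j = (Π^temp_{X_K} ↠ G_K)`) is continuous and OPEN,
with kernel `Δ^temp_X ⧸ admKer_j`.**  Openness: `qtp_j` is surjective and continuous and `Π^temp_{X_K} ↠ G_K` is open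
because `Π^temp_{X_K}` is tempered and Galois-countable (abc-iut-L3's `TemperedCurve.isOpenMap_augGK_of_isTempered`,
[SemiAnbd] §6 p.69). ([IUTchI] Prop 2.4(ii) p.51; [SemiAnbd] §6 p.69) [claim: Mochizuki2012, status: disputed] -/
theorem canonicalAug_continuous_isOpenMap_ker (P : SpecialFibreTower.PiData X d S T) (j : ℕ)
    (a : ((qTowerOfSpecialFibreTower X T d S h36 Sigma SigmaHat hsub hne hprime hp TpH HatH hle cuspMeetsH P.admKer_normal_pi).Q j).Tp →* X.GK)
    (ha : a.comp ((qTowerOfSpecialFibreTower X T d S h36 Sigma SigmaHat hsub hne hprime hp TpH HatH hle cuspMeetsH P.admKer_normal_pi).qtp j) = X.augGK.toMonoidHom) :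
    Continuous a ∧ IsOpenMap a ∧
      a.ker = X.DeltaTemp.map ((qTowerOfSpecialFibreTower X T d S h36 Sigma SigmaHat hsub hne hprime hp TpH HatH hle cuspMeetsH P.admKer_normal_pi).qtp j) := by
  haveI hA : (admKerPi X T j).Normal := P.admKer_normal_pi j
  have hqsurj : Function.Surjective ((qTowerOfSpecialFibreTower X T d S h36 Sigma SigmaHat hsub hne hprime hp TpH HatH hle cuspMeetsH P.admKer_normal_pi).qtp j) :=
    qTower_qtp_surjective X T d S h36 Sigma SigmaHat hsub hne hprime hp TpH HatH hle cuspMeetsH P.admKer_normal_pi j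
  have hq : IsOpenQuotientMap ((qTowerOfSpecialFibreTower X T d S h36 Sigma SigmaHat hsub hne hprime hp TpH HatH hle cuspMeetsH P.admKer_normal_pi).qtp j) := by
    change IsOpenQuotientMap (QuotientGroup.mk' (admKerPi X T j))
    exact QuotientGroup.isOpenQuotientMap_mk
  have hcoe : (a : ((qTowerOfSpecialFibreTower X T d S h36 Sigma SigmaHat hsub hne hprime hp TpH HatH hle cuspMeetsH P.admKer_normal_pi).Q j).Tp → X.GK) ∘ ((qTowerOfSpecialFibreTower X T d S h36 Sigma SigmaHat hsub hne hprime hp TpH HatH hle cuspMeetsH P.admKer_normal_pi).qtp j) =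
      (X.augGK.toMonoidHom : X.PiTemp → X.GK) :=
    congrArg (fun f : X.PiTemp →* X.GK => (f : X.PiTemp → X.GK)) ha
  refine ⟨?_, ?_, ?_⟩
  · refine hq.continuous_comp_iff.mp ?_
    rw [hcoe]
    exact X.augGK.continuous
  · haveI := d.secondCountableTopology
    have hopen : IsOpenMap X.augGK := X.isOpenMap_augGK_of_isTempered d.isTempered
    intro U hU
    rw [← Set.image_preimage_eq U hqsurj, ← Set.image_comp, hcoe]
    exact hopen _ (hU.preimage hq.continuous)
  · rw [← Subgroup.map_comap_eq_self_of_surjective hqsurj a.ker, MonoidHom.comap_ker, ha, ker_augGK_eq_deltaTemp]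

/-- **The §2 `hI` socket is FRAME-INDEPENDENT.**  At every level `j` of the genuine quotient tower over `P`, for the
canonical Prop 5.2 (iv) frame `πA_j : Π^tp_j ↠ Π^tp_j ⧸ N̄_j` (`Ker = π₁^temp(𝒢_j)`) and the canonical augmentation
`a_j : Π^tp_j → G_K` (`Ker = Δ^temp_X ⧸ admKer_j ⊋ N̄_j`):
`ArithMaximalCompactStatementI (Dd j) πA_j ↔ ArithMaximalCompactStatementI (Dd j) a_j`.
`→` is p485729's finite-index DESCENT (`N̄_j` closed normal of index `[Δ^temp_X : N_j] < ∞` in `Ker a_j`,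
`SpecialFibreTower.N_finiteIndex`); `←` is the ASCENT of § A through the OPEN map `a_j`
(`canonicalAug_continuous_isOpenMap_ker`).  So the law of p467772 (canonical frame), the literal law of p485729 (any
open frame killing `N̄_j`) and the frame law are logically equivalent; the frame TYPE is the one matching abc-iut-L3's
Thm 5.4 output (`hexact : ι.range = aug.ker`).  Nothing of Thm 5.4 is proved.
([IUTchI] Prop 2.4(ii) p.51; [SemiAnbd] Thm 5.4 (i) p.66, Prop 5.2 (iv) p.64) [claim: Mochizuki2012, status: disputed] -/
theorem arithStatementI_frame_iff_canonical (P : SpecialFibreTower.PiData X d S T) {V B : ℕ → Type*}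
    (Dd : ∀ j, DecompositionData ((qTowerOfSpecialFibreTower X T d S h36 Sigma SigmaHat hsub hne hprime hp TpH HatH hle cuspMeetsH P.admKer_normal_pi).Q j).Tp (V j) (B j))
    (j : ℕ) (a : ((qTowerOfSpecialFibreTower X T d S h36 Sigma SigmaHat hsub hne hprime hp TpH HatH hle cuspMeetsH P.admKer_normal_pi).Q j).Tp →* X.GK)
    (ha : a.comp ((qTowerOfSpecialFibreTower X T d S h36 Sigma SigmaHat hsub hne hprime hp TpH HatH hle cuspMeetsH P.admKer_normal_pi).qtp j) = X.augGK.toMonoidHom) :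
    (haveI := qTower_map_N_normal X d T Sigma SigmaHat hsub hne hprime S h36 hp TpH HatH hle cuspMeetsH P j;
      ArithMaximalCompactStatementI (Dd j)
        (QuotientGroup.mk' (((T.N j).map X.DeltaTemp.subtype).map ((qTowerOfSpecialFibreTower X T d S h36 Sigma SigmaHat hsub hne hprime hp TpH HatH hle cuspMeetsH P.admKer_normal_pi).qtp j)))) ↔
      ArithMaximalCompactStatementI (Dd j) a := by
  haveI hA : (admKerPi X T j).Normal := P.admKer_normal_pi j
  haveI hN := qTower_map_N_normal X d T Sigma SigmaHat hsub hne hprime S h36 hp TpH HatH hle cuspMeetsH P j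
  obtain ⟨hac, hao, hkera⟩ :=
    canonicalAug_continuous_isOpenMap_ker X d T Sigma SigmaHat hsub hne hprime S h36 hp TpH HatH hle cuspMeetsH P j a ha
  have hker : ((qTowerOfSpecialFibreTower X T d S h36 Sigma SigmaHat hsub hne hprime hp TpH HatH hle cuspMeetsH P.admKer_normal_pi).qtp j).ker = admKerPi X T j := by
    change (QuotientGroup.mk' (admKerPi X T j)).ker = _
    exact QuotientGroup.ker_mk' _
  have hAN : admKerPi X T j ≤ (T.N j).map X.DeltaTemp.subtype := admKerPi_le_map_N X T j
  have hNΔ : (T.N j).map X.DeltaTemp.subtype ≤ X.DeltaTemp := Subgroup.map_subtype_le _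
  -- `N̄_j ≤ Ker a_j`, with finite index `[Δ^temp_X : N_j]`
  have hNa : ((T.N j).map X.DeltaTemp.subtype).map ((qTowerOfSpecialFibreTower X T d S h36 Sigma SigmaHat hsub hne hprime hp TpH HatH hle cuspMeetsH P.admKer_normal_pi).qtp j) ≤ a.ker := by
    rw [hkera]
    exact Subgroup.map_mono hNΔ
  have hidx : ((T.N j).map X.DeltaTemp.subtype).relIndex X.DeltaTemp = (T.N j).index := by
    have h := Subgroup.relIndex_map_map_of_injective (T.N j) ⊤ X.DeltaTemp.subtype_injective
    rw [Subgroup.relIndex_top_right, ← MonoidHom.range_eq_map, Subgroup.range_subtype] at h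
    exact h
  have hfin : (((T.N j).map X.DeltaTemp.subtype).map ((qTowerOfSpecialFibreTower X T d S h36 Sigma SigmaHat hsub hne hprime hp TpH HatH hle cuspMeetsH P.admKer_normal_pi).qtp j)).relIndex a.ker ≠ 0 := by
    rw [hkera, Subgroup.relIndex_map_map, hker, sup_eq_left.mpr hAN, sup_eq_left.mpr (hAN.trans hNΔ), hidx]
    exact (T.N_finiteIndex j).index_ne_zero
  -- the frame: kernel `N̄_j` exactly, continuous
  have hkerπ : (QuotientGroup.mk' (((T.N j).map X.DeltaTemp.subtype).map ((qTowerOfSpecialFibreTower X T d S h36 Sigma SigmaHat hsub hne hprime hp TpH HatH hle cuspMeetsH P.admKer_normal_pi).qtp j))).ker =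
      ((T.N j).map X.DeltaTemp.subtype).map ((qTowerOfSpecialFibreTower X T d S h36 Sigma SigmaHat hsub hne hprime hp TpH HatH hle cuspMeetsH P.admKer_normal_pi).qtp j) :=
    QuotientGroup.ker_mk' _
  have hπc : Continuous (QuotientGroup.mk' (((T.N j).map X.DeltaTemp.subtype).map ((qTowerOfSpecialFibreTower X T d S h36 Sigma SigmaHat hsub hne hprime hp TpH HatH hle cuspMeetsH P.admKer_normal_pi).qtp j))) :=
    QuotientGroup.continuous_mk
  constructor
  · intro hI
    exact ArithAmpleDescent.arithMaximalCompactStatementI_of_isOpenMap (Dd j) hac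
      (isOpenMap_frame X d T Sigma SigmaHat hsub hne hprime S h36 hp TpH HatH hle cuspMeetsH P j) _
      (isClosed_qTower_map_N X d T Sigma SigmaHat hsub hne hprime S h36 hp TpH HatH hle cuspMeetsH P j)
      hkerπ.ge hNa hfin hI
  · intro hI
    exact ArithAmpleDescent.arithMaximalCompactStatementI_of_ker_le (Dd j) hao hπc (hkerπ.le.trans hNa) hI

/-- **[IUTchI] Prop. 2.4 (i)(ii)(iii) ∧ Cor. 2.5 AS TYPED at the genuine 𝔛-datum over `P`, ONE CALL, the per-level
Thm 5.4 (i) binder at the CANONICAL [SemiAnbd] Prop 5.2 (iv) frame** — p485729's one-call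
`prop24_cor25_ofPiData_byName_noRF_literal` with the displayed frame data `{PA j, α j, hαo, hαN}` ELIMINATED
(`α_j := πA_j : Π^tp_j ↠ Π^tp_j ⧸ N̄_j`, constructed).  LAW list: hTF ([Config] Rmk 1.2.2 printed form) · hNN_i (F-2540) ·
hab · hadm · hI_j^frame (`ArithMaximalCompactStatementI (Dd j) πA_j`, `Ker πA_j = π₁^temp(𝒢_j)` — [SemiAnbd] Thm 5.4 (i)
in the frame of Prop 5.2 (iv)) · hA3ar_j = 6; data/side conditions as in p467772/p485729.
([IUTchI] Prop 2.4, Cor 2.5 pp.50-51; [SemiAnbd] Thm 5.4 (i) p.66, Prop 5.2 (iv) p.64) [claim: Mochizuki2012, status: disputed] -/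
theorem prop24_cor25_ofPiData_byName_noRF_frame (P : SpecialFibreTower.PiData X d S T) (x : {x : X.Pt // X.IsCusp x})
    -- (i): [Config] Rmk 1.2.2, printed form on `X.DeltaHat`
    (hTF : ∀ H : Subgroup X.DeltaHat, IsOpen (H : Set X.DeltaHat) →
      ∀ (h : H) (n : ℕ), n ≠ 0 →
        SigmaCharDetects Set.univ H h → SigmaCharDetects Set.univ H (h ^ n))
    -- (i): per-level PSC data with (A3) := F-2540 BY NAME and the identification side conditions
    (G : ∀ i, PSCDatum (levelGraph X T Sigma SigmaHat hsub hne hprime i).Hat)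
    (hNN : ∀ i, (G i).VerticialIntersectionNear)
    (σ : ∀ i, (T.Gc i).graph.Vertex ≃ (G i).graph.V) (Λv : ∀ i, (G i).graph.V → Subgroup (T.chart i).G)
    (hvert : ∀ i (v : (T.Gc i).graph.Vertex), Λv i (σ i v) ∈ verticialSubgroups (T.chart i) v)
    (hΛv : ∀ i v, (Λv i v).map (levelGraph X T Sigma SigmaHat hsub hne hprime i).ι = (G i).vertGp v)
    (src tgt : ∀ i, (G i).graph.N → (G i).graph.V) (c₁ c₂ : ∀ i, (G i).graph.N → (T.chart i).G)
    (hends : ∀ i e, (G i).graph.nodeEnds e = s(src i e, tgt i e))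
    (h₁ : ∀ i e, (G i).nodeGp e ≤
      MulAut.conj ((levelGraph X T Sigma SigmaHat hsub hne hprime i).ι (c₁ i e)) • (G i).vertGp (src i e))
    (h₂ : ∀ i e, (G i).nodeGp e ≤
      MulAut.conj ((levelGraph X T Sigma SigmaHat hsub hne hprime i).ι (c₂ i e)) • (G i).vertGp (tgt i e))
    (hloop : ∀ i e, src i e = tgt i e → (c₁ i e)⁻¹ * c₂ i e ∉ Λv i (src i e))
    -- (i): the pro-`Σ` abelianization law along the admissible quotients
    (hab : ∀ (i : ℕ) (A : Type) [CommGroup A] [Finite A] (χ : T.N i →* A),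
      IsOpen ((χ.ker : Subgroup (T.N i)) : Set (T.N i)) →
      (∀ q : ℕ, q.Prime → q ∣ Nat.card A → q ∈ Sigma) → (T.adm i).toMonoidHom.ker ≤ χ.ker)
    -- (i)(ii): the admissible kernels shrink to `1`
    (hadm : ∀ U ∈ 𝓝 (1 : ↥X.DeltaTemp), ∃ j, ((T.admKer j : Subgroup ↥X.DeltaTemp) : Set ↥X.DeltaTemp) ⊆ U)
    -- (ii): per-level arithmetic decomposition data, node data, (A3-arith)_j
    {V B : ℕ → Type*}
    (Dd : ∀ j, DecompositionData ((qTowerOfSpecialFibreTower X T d S h36 Sigma SigmaHat hsub hne hprime hp TpH HatH hle cuspMeetsH P.admKer_normal_pi).Q j).Tp (V j) (B j))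
    -- (ii): [SemiAnbd] Thm 5.4 (i) at the CANONICAL Prop 5.2 (iv) frame `Π^tp_j ↠ Π^tp_j ⧸ π₁^temp(𝒢_j)`
    (hI : ∀ j, haveI := qTower_map_N_normal X d T Sigma SigmaHat hsub hne hprime S h36 hp TpH HatH hle cuspMeetsH P j;
      ArithMaximalCompactStatementI (Dd j)
        (QuotientGroup.mk' (((T.N j).map X.DeltaTemp.subtype).map ((qTowerOfSpecialFibreTower X T d S h36 Sigma SigmaHat hsub hne hprime hp TpH HatH hle cuspMeetsH P.admKer_normal_pi).qtp j))))
    {EA : ℕ → Type*} (srcA tgtA : ∀ j, EA j → V j)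
    (c₁A c₂A : ∀ j, EA j → ((qTowerOfSpecialFibreTower X T d S h36 Sigma SigmaHat hsub hne hprime hp TpH HatH hle cuspMeetsH P.admKer_normal_pi).Q j).Tp)
    (hA3ar : ∀ (j : ℕ) (Λ : Subgroup X.PiTemp), IsCompact (Λ : Set X.PiTemp) → Λ ≠ ⊥ →
      IsOpen (Λ.map X.augGK.toMonoidHom : Set X.GK) →
      ∀ (v w : V j) (g h γ : ((qTowerOfSpecialFibreTower X T d S h36 Sigma SigmaHat hsub hne hprime hp TpH HatH hle cuspMeetsH P.admKer_normal_pi).Q j).Hat),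
        MulAut.conj γ • Λ.map (((qTowerOfSpecialFibreTower X T d S h36 Sigma SigmaHat hsub hne hprime hp TpH HatH hle cuspMeetsH P.admKer_normal_pi).qhat j).comp X.toHat.toMonoidHom) ≤
            MulAut.conj g • ((Dd j).vertGp v).map ((qTowerOfSpecialFibreTower X T d S h36 Sigma SigmaHat hsub hne hprime hp TpH HatH hle cuspMeetsH P.admKer_normal_pi).Q j).ι →
        MulAut.conj γ • Λ.map (((qTowerOfSpecialFibreTower X T d S h36 Sigma SigmaHat hsub hne hprime hp TpH HatH hle cuspMeetsH P.admKer_normal_pi).qhat j).comp X.toHat.toMonoidHom) ≤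
            MulAut.conj h • ((Dd j).vertGp w).map ((qTowerOfSpecialFibreTower X T d S h36 Sigma SigmaHat hsub hne hprime hp TpH HatH hle cuspMeetsH P.admKer_normal_pi).Q j).ι →
          (v = w ∧ g⁻¹ * h ∈ ((Dd j).vertGp v).map ((qTowerOfSpecialFibreTower X T d S h36 Sigma SigmaHat hsub hne hprime hp TpH HatH hle cuspMeetsH P.admKer_normal_pi).Q j).ι) ∨
          (∃ (e : EA j) (k : ((qTowerOfSpecialFibreTower X T d S h36 Sigma SigmaHat hsub hne hprime hp TpH HatH hle cuspMeetsH P.admKer_normal_pi).Q j).Hat),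
            ∃ p ∈ ((Dd j).vertGp (srcA j e)).map ((qTowerOfSpecialFibreTower X T d S h36 Sigma SigmaHat hsub hne hprime hp TpH HatH hle cuspMeetsH P.admKer_normal_pi).Q j).ι,
            ∃ q ∈ ((Dd j).vertGp (tgtA j e)).map ((qTowerOfSpecialFibreTower X T d S h36 Sigma SigmaHat hsub hne hprime hp TpH HatH hle cuspMeetsH P.admKer_normal_pi).Q j).ι,
            (srcA j e = v ∧ tgtA j e = w ∧
                g = k * ((qTowerOfSpecialFibreTower X T d S h36 Sigma SigmaHat hsub hne hprime hp TpH HatH hle cuspMeetsH P.admKer_normal_pi).Q j).ι (c₁A j e) * p ∧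
                h = k * ((qTowerOfSpecialFibreTower X T d S h36 Sigma SigmaHat hsub hne hprime hp TpH HatH hle cuspMeetsH P.admKer_normal_pi).Q j).ι (c₂A j e) * q) ∨
            (srcA j e = w ∧ tgtA j e = v ∧
                h = k * ((qTowerOfSpecialFibreTower X T d S h36 Sigma SigmaHat hsub hne hprime hp TpH HatH hle cuspMeetsH P.admKer_normal_pi).Q j).ι (c₁A j e) * p ∧
                g = k * ((qTowerOfSpecialFibreTower X T d S h36 Sigma SigmaHat hsub hne hprime hp TpH HatH hle cuspMeetsH P.admKer_normal_pi).Q j).ι (c₂A j e) * q)) ∨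
          (∃ (u : V j) (f : ((qTowerOfSpecialFibreTower X T d S h36 Sigma SigmaHat hsub hne hprime hp TpH HatH hle cuspMeetsH P.admKer_normal_pi).Q j).Hat),
            (∃ (e : EA j) (k : ((qTowerOfSpecialFibreTower X T d S h36 Sigma SigmaHat hsub hne hprime hp TpH HatH hle cuspMeetsH P.admKer_normal_pi).Q j).Hat),
              ∃ p ∈ ((Dd j).vertGp (srcA j e)).map ((qTowerOfSpecialFibreTower X T d S h36 Sigma SigmaHat hsub hne hprime hp TpH HatH hle cuspMeetsH P.admKer_normal_pi).Q j).ι,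
              ∃ q ∈ ((Dd j).vertGp (tgtA j e)).map ((qTowerOfSpecialFibreTower X T d S h36 Sigma SigmaHat hsub hne hprime hp TpH HatH hle cuspMeetsH P.admKer_normal_pi).Q j).ι,
              (srcA j e = v ∧ tgtA j e = u ∧
                  g = k * ((qTowerOfSpecialFibreTower X T d S h36 Sigma SigmaHat hsub hne hprime hp TpH HatH hle cuspMeetsH P.admKer_normal_pi).Q j).ι (c₁A j e) * p ∧
                  f = k * ((qTowerOfSpecialFibreTower X T d S h36 Sigma SigmaHat hsub hne hprime hp TpH HatH hle cuspMeetsH P.admKer_normal_pi).Q j).ι (c₂A j e) * q) ∨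
              (srcA j e = u ∧ tgtA j e = v ∧
                  f = k * ((qTowerOfSpecialFibreTower X T d S h36 Sigma SigmaHat hsub hne hprime hp TpH HatH hle cuspMeetsH P.admKer_normal_pi).Q j).ι (c₁A j e) * p ∧
                  g = k * ((qTowerOfSpecialFibreTower X T d S h36 Sigma SigmaHat hsub hne hprime hp TpH HatH hle cuspMeetsH P.admKer_normal_pi).Q j).ι (c₂A j e) * q)) ∧
            (∃ (e : EA j) (k : ((qTowerOfSpecialFibreTower X T d S h36 Sigma SigmaHat hsub hne hprime hp TpH HatH hle cuspMeetsH P.admKer_normal_pi).Q j).Hat),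
              ∃ p ∈ ((Dd j).vertGp (srcA j e)).map ((qTowerOfSpecialFibreTower X T d S h36 Sigma SigmaHat hsub hne hprime hp TpH HatH hle cuspMeetsH P.admKer_normal_pi).Q j).ι,
              ∃ q ∈ ((Dd j).vertGp (tgtA j e)).map ((qTowerOfSpecialFibreTower X T d S h36 Sigma SigmaHat hsub hne hprime hp TpH HatH hle cuspMeetsH P.admKer_normal_pi).Q j).ι,
              (srcA j e = u ∧ tgtA j e = w ∧
                  f = k * ((qTowerOfSpecialFibreTower X T d S h36 Sigma SigmaHat hsub hne hprime hp TpH HatH hle cuspMeetsH P.admKer_normal_pi).Q j).ι (c₁A j e) * p ∧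
                  h = k * ((qTowerOfSpecialFibreTower X T d S h36 Sigma SigmaHat hsub hne hprime hp TpH HatH hle cuspMeetsH P.admKer_normal_pi).Q j).ι (c₂A j e) * q) ∨
              (srcA j e = w ∧ tgtA j e = u ∧
                  h = k * ((qTowerOfSpecialFibreTower X T d S h36 Sigma SigmaHat hsub hne hprime hp TpH HatH hle cuspMeetsH P.admKer_normal_pi).Q j).ι (c₁A j e) * p ∧
                  f = k * ((qTowerOfSpecialFibreTower X T d S h36 Sigma SigmaHat hsub hne hprime hp TpH HatH hle cuspMeetsH P.admKer_normal_pi).Q j).ι (c₂A j e) * q)))) :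
    ((ofSpecialFibre X d S h36 Sigma SigmaHat hsub hne hprime hp TpH HatH hle cuspMeetsH).Prop24i ∧
      (ofSpecialFibre X d S h36 Sigma SigmaHat hsub hne hprime hp TpH HatH hle cuspMeetsH).Prop24ii ∧
      (ofSpecialFibre X d S h36 Sigma SigmaHat hsub hne hprime hp TpH HatH hle cuspMeetsH).Prop24iii) ∧
    ((ofSpecialFibre X d S h36 Sigma SigmaHat hsub hne hprime hp TpH HatH hle cuspMeetsH).Cor25Decomposition ∧
      (ofSpecialFibre X d S h36 Sigma SigmaHat hsub hne hprime hp TpH HatH hle cuspMeetsH).Cor25Inertia) := by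
  haveI hN : ∀ j, (((T.N j).map X.DeltaTemp.subtype).map ((qTowerOfSpecialFibreTower X T d S h36 Sigma SigmaHat hsub hne hprime hp TpH HatH hle cuspMeetsH P.admKer_normal_pi).qtp j)).Normal :=
    fun j => qTower_map_N_normal X d T Sigma SigmaHat hsub hne hprime S h36 hp TpH HatH hle cuspMeetsH P j
  exact prop24_cor25_ofPiData_byName_noRF_literal X d T Sigma SigmaHat hsub hne hprime S h36 hp TpH HatH hle cuspMeetsH
    P x hTF G hNN σ Λv hvert hΛv src tgt c₁ c₂ hends h₁ h₂ hloop hab hadm Dd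
    (PA := fun j => ((qTowerOfSpecialFibreTower X T d S h36 Sigma SigmaHat hsub hne hprime hp TpH HatH hle cuspMeetsH P.admKer_normal_pi).Q j).Tp ⧸
      ((T.N j).map X.DeltaTemp.subtype).map ((qTowerOfSpecialFibreTower X T d S h36 Sigma SigmaHat hsub hne hprime hp TpH HatH hle cuspMeetsH P.admKer_normal_pi).qtp j))
    (fun j => QuotientGroup.mk' _)
    (fun j => isOpenMap_frame X d T Sigma SigmaHat hsub hne hprime S h36 hp TpH HatH hle cuspMeetsH P j)
    (fun j n hn => frame_apply_eq_one X d T Sigma SigmaHat hsub hne hprime S h36 hp TpH HatH hle cuspMeetsH P j n hn)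
    hI srcA tgtA c₁A c₂A hA3ar

end OfSpecialFibre

end StableCurveTemperedData

end Literature.IUT.HodgeTheaters

end
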